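import Summits.BirchSwinnertonDyer.Rank1Residual.P2.KrizLiSmallCMBase
import Summits.BirchSwinnertonDyer.Rank1Residual.P2.KrizLiFortyFiveSixtyThree
import HarnessLib

/-!
# Cell `bsd-print-cf2` (D-0131 (2) PRINT TIER, leaf CornerF @ `p = 2`), typer ty2 — the (★)-CERTIFIED
# bases `1323a1`, `1323m1`, `4563a1` as MEMBERS of the generic Kriz–Li family
# `P2.IsIsogenousToKrizLiTwistOfSmallCMBase` (prover p3), the (★)-datum DISPLAYED as `P2.HasKrizLiStarDatum`

HONEST FRAMING. Glue (ty2: leaf-side predicate ⟹ the cited theorem's hypotheses) between the per-base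
SETTINGS `P2/KrizLiThirteenTwentyThree.lean`, `P2/KrizLiFortyFiveSixtyThree.lean` (+ the generic
`P2/KrizLiJZeroSetting.lean`) and prover p3's base- and field-generic Kriz–Li door
`P2/KrizLiSmallCMBase{Transport,}.lean`: `BSD(W′, 2)` BY NAME (`bsdp_two_of_isIsogenousToKrizLiTwistOfSmallCMBase`,
seven facts `hKL h33 hS31 hBF hmod hGZK hCassels`, NO table fact; aside stmt-BirchSwinnertonDyer-21366
`InertKrizLiStarDoorOfFactsPlus` of route PrintCf2) for every globally minimal `W′` satisfying the
MEMBERSHIP predicate `IsIsogenousToKrizLiTwistOfSmallCMBase W′`. Here, for each of the three bases GOOD at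
`2` typed by this seat, ONE TERM builds that membership from: an imaginary quadratic `K` with the two
Kronecker conditions that make `N(E) ∣ 3³·q²` Heegner (`(d_K/3) = (d_K/q) = 1`, `q = 7, 13`), the
DISPLAYED (★)-datum `hSD : HasKrizLiStarDatum curveX K` (a CERTIFICATE — cell dossier §14.4/§14.8, 118
exact (★)-pairs, NOT print; currency LITERAL-by-name((★)-display)), `d ∈ 𝒩(E, K)` (also from explicit
decidable data: `inN_curveX_of_explicit`), `d > 0`, `d ≡ 1 (mod 12)`, `q ∤ d` (the kernel's sign clause),
and a `ℚ`-isogeny `W′ ~ E^{(d)}` or `W′ ~ E^{(d·d_K)}`; everything else (CM, `N < 5000`, `1 ≤ rank`,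
`E(ℚ)[2] = 0`, `c₂ = 1`, Heegner) is discharged in the kernel by the setting files — exactly as p3's
`isIsogenousToKrizLiTwistOfSmallCMBase_of_twoFortyThree` does for the PRINTED pair `(243a1, ℚ(√−23))`.
Also the specialisations to the certified discriminants (`d_K = −47` for `1323a1`, `1323m1`; `−23` for
`4563a1`). No named fact; nothing asserted; the leaf is OPEN AS A CLASS; beyond print: NO.

References: [KrizLi2019] Thm 5.1 (2) = arXiv:1606.03172 Thm 1.12, Def 4.1, §6 Ex. 6.2, Rem. 6.3;
[Cremona1997] Table 1 (1323a1, 1323m1, 4563a1); cell dossier §14.4, §14.6, §14.8 (certified pairs).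
-/

noncomputable section

open scoped Classical

open WeierstrassCurve NumberField Literature.NumberTheory.EllipticCurves
  Literature.NumberTheory.EllipticCurves.Rank1Residual
  Literature.NumberTheory.EllipticCurves.ModularForms
  Summit.BirchSwinnertonDyer.Rank1Residual

set_option autoImplicit false

namespace Summit.BirchSwinnertonDyer.Rank1Residual.P2

/-! ### Placement of the ISOGENY CLASSES of the `E_a`-families: INERT-GOOD -/

/-- **Every curve `ℚ`-isogenous to a twist `E_a^{(e)}`, `e ≡ 1 (mod 4)`, has GOOD reduction at `2`** (good
reduction is an isogeny invariant, Serre–Tate; tree `IsIsogenous.hasGoodReductionAtPrime_iff`): the Kriz–Li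
classes of every base of shape `y² + y = x³ + a` lie in the INERT-GOOD cell of crux `InertJZeroOfFacts`
(`d ∈ 𝒩 ⇒ d ≡ 1 (mod 4)`, and `d·d_K ≡ 1 (mod 4)` too). [cite: SilvermanAEC2009, Cor. VII.7.2 and VII.5 Prop. 5.1(a)] -/
theorem good_two_of_isIsogenous_twist_cubicA₃ (a : ℤ) {e : ℤ} (he : e % 4 = 1) {W : WeierstrassCurve ℚ}
    [W.IsElliptic] (h : IsIsogenous W ((cubicA₃ a).quadraticTwist (e : ℚ))) : Good W 2 := by
  have he0 : (e : ℚ) ≠ 0 := by exact_mod_cast (show e ≠ 0 by omega)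
  haveI := (cubicA₃ a).isElliptic_quadraticTwist he0
  exact (h.hasGoodReductionAtPrime_iff 2).2
    (good_two_of_smul_twist_cubicA₃ a he (C := (1 : VariableChange ℚ)) (one_smul _ _))

/-- **CM along the classes**: every curve `ℚ`-isogenous to a twist of `E_a` has CM (tree
`hasCM_of_isIsogenous_twist_of_hasCM`, prover p3). [cite: SilvermanAEC2009, Appendix C §11] -/
theorem hasCM_of_isIsogenous_twist_cubicA₃ (a : ℤ) {e : ℚ} (he : e ≠ 0) {W : WeierstrassCurve ℚ}
    [W.IsElliptic] (h : IsIsogenous W ((cubicA₃ a).quadraticTwist e)) : W.HasCM :=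
  hasCM_of_isIsogenous_twist_of_hasCM (cubicA₃ a) (hasCM_cubicA₃ a) he W h

/-! ### `1323a1` (`= cubicA₃ 600`, good at `2`; certified field `ℚ(√−47)`) -/

/-- **The Kriz–Li classes of `1323a1` are MEMBERS of the generic family** — in ANY imaginary quadratic `K`
with `(d_K/3) = (d_K/7) = 1` carrying a (★)-datum `hSD : HasKrizLiStarDatum curve1323a1 K` (the DISPLAYED
certificate; `2` split in `K` is inside (★)), for `d ∈ 𝒩(E, K)`, `d > 0`, `d ≡ 1 (mod 12)`, `7 ∤ d`: every
`W'` `ℚ`-isogenous to `E^{(d)}` or `E^{(d·d_K)}`. Everything about the base is discharged in the kernel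
(`KrizLiJZeroSetting`, `KrizLi…` base file). [cite: KrizLi2019, Thm. 5.1 (2), Def. 4.1, §6 Ex. 6.2] -/
theorem isIsogenousToKrizLiTwistOfSmallCMBase_of_curve1323a1 {K : Type} [Field K] [NumberField K]
    (hK : IsImaginaryQuadratic K) (h3 : jacobiSym (NumberField.discr K) 3 = 1)
    (hq : jacobiSym (NumberField.discr K) 7 = 1) (hSD : HasKrizLiStarDatum curve1323a1 K)
    {d : ℤ} (hd : KrizLi2019.InN curve1323a1 K d) (hd0 : 0 < d) (hd12 : d % 12 = 1) (hqd : ¬ (7 : ℤ) ∣ d)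
    {W' : WeierstrassCurve ℚ}
    (hiso : IsIsogenous W' (curve1323a1.quadraticTwist (d : ℚ)) ∨
      IsIsogenous W' (curve1323a1.quadraticTwist ((d * NumberField.discr K : ℤ) : ℚ))) :
    IsIsogenousToKrizLiTwistOfSmallCMBase W' := by
  haveI : Fact (2 : ℕ).Prime := ⟨Nat.prime_two⟩
  exact ⟨curve1323a1, inferInstance, inferInstance, inferInstance, hasCM_cubicA₃ 600,
    conductorNorm_curve1323a1_lt, one_le_mordellWeilRank_curve1323a1, twoTorsion_cubicA₃ 600,
    (by rw [localTamagawaNumber_two_cubicA₃]; exact odd_one), K, inferInstance, inferInstance, hK,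
    satisfiesHeegnerHypothesis_curve1323a1 hK.1 h3 hq, hSD, d, hd,
    sign_mul_jacobiSym_conductorNorm_curve1323a1 hd0 hd12 hqd, hiso⟩

/-- **`d ∈ 𝒩(1323a1, K)` from EXPLICIT, DECIDABLE data on the prime factors of `d`**: `d ≡ 1 (mod 4)`,
`|d|` square-free, and every prime `ℓ ∣ d` has `ℓ ∉ {2, 3, 7}`, `(d_K/ℓ) = 1` and an even number of cube
roots of `−16(4·600+1)` in `𝔽_ℓ`. [cite: KrizLi2019, Def. 4.1 (FMS) = arXiv Def. 3.1] -/
theorem inN_curve1323a1_of_explicit {K : Type} [Field K] [NumberField K] (h2 : Module.finrank ℚ K = 2)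
    {d : ℤ} (hd4 : d % 4 = 1) (hsq : Squarefree d.natAbs)
    (hprimes : ∀ (ℓ : ℕ) (hℓ : ℓ.Prime), ℓ ∣ d.natAbs → haveI : NeZero ℓ := ⟨hℓ.ne_zero⟩;
      ℓ ≠ 2 ∧ ℓ ≠ 3 ∧ ℓ ≠ 7 ∧ jacobiSym (NumberField.discr K) ℓ = 1 ∧
      Even ((Finset.univ.filter fun x : ZMod ℓ => x ^ 3 = -(16 * (4 * (600 : ZMod ℓ) + 1))).card)) :
    KrizLi2019.InN curve1323a1 K d := by
  refine inN_of_explicit (S := fun ℓ => ∃ hℓ : ℓ.Prime, haveI : NeZero ℓ := ⟨hℓ.ne_zero⟩;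
      ℓ ≠ 2 ∧ ℓ ≠ 3 ∧ ℓ ≠ 7 ∧ jacobiSym (NumberField.discr K) ℓ = 1 ∧
      Even ((Finset.univ.filter fun x : ZMod ℓ => x ^ 3 = -(16 * (4 * (600 : ZMod ℓ) + 1))).card))
    (fun ℓ ⟨hℓ, h⟩ => ?_) hd4 hsq (fun ℓ hℓ hℓd => ⟨hℓ, hprimes ℓ hℓ hℓd⟩)
  haveI : NeZero ℓ := ⟨hℓ.ne_zero⟩
  obtain ⟨hℓ2, hℓ3, hℓq, hj, hev⟩ := h
  have ha : ¬ (ℓ : ℤ) ∣ 4 * 600 + 1 := fun h => by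
    have hℓp : Prime (ℓ : ℤ) := Nat.prime_iff_prime_int.mp hℓ
    have h' : (ℓ : ℤ) ∣ 7 ^ 5 := h.trans (by norm_num)
    exact hℓq ((Nat.prime_dvd_prime_iff_eq hℓ (by norm_num)).mp
      (Int.natCast_dvd_natCast.mp (by exact_mod_cast hℓp.dvd_of_dvd_pow h')))
  refine inS_of_explicit h2 hℓ hℓ2 (not_dvd_two_mul_conductorNorm_curve1323a1 hℓ hℓ2 hℓ3 hℓq) hj ?_
  rw [odd_frobeniusTrace_cubicA₃_iff 600 hℓ hℓ2 hℓ3 ha]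
  push_cast at hev ⊢
  exact hev

/-- **Membership at the CERTIFIED field `K`, `d_K = −47`** (the lit seat's exact (★) certificate, cell
dossier §14.8, is stated for this pair). [cite: KrizLi2019, Thm. 5.1 (2) and §6 Ex. 6.2] -/
theorem isIsogenousToKrizLiTwistOfSmallCMBase_of_curve1323a1_of_discr_eq {K : Type} [Field K]
    [NumberField K] (hK : IsImaginaryQuadratic K) (hdK : NumberField.discr K = -47)
    (hSD : HasKrizLiStarDatum curve1323a1 K) {d : ℤ} (hd : KrizLi2019.InN curve1323a1 K d) (hd0 : 0 < d)
    (hd12 : d % 12 = 1) (hqd : ¬ (7 : ℤ) ∣ d) {W' : WeierstrassCurve ℚ}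
    (hiso : IsIsogenous W' (curve1323a1.quadraticTwist (d : ℚ)) ∨
      IsIsogenous W' (curve1323a1.quadraticTwist ((-47 * d : ℤ) : ℚ))) :
    IsIsogenousToKrizLiTwistOfSmallCMBase W' := by
  refine isIsogenousToKrizLiTwistOfSmallCMBase_of_curve1323a1 hK (by rw [hdK]; norm_num)
    (by rw [hdK]; norm_num) hSD hd hd0 hd12 hqd ?_
  rw [hdK, mul_comm]
  exact hiso

/-! ### `1323m1` (`= cubicA₃ (-2)`, good at `2`; certified field `ℚ(√−47)`) -/

/-- **The Kriz–Li classes of `1323m1` are MEMBERS of the generic family** — in ANY imaginary quadratic `K`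
with `(d_K/3) = (d_K/7) = 1` carrying a (★)-datum `hSD : HasKrizLiStarDatum curve1323m1 K` (the DISPLAYED
certificate; `2` split in `K` is inside (★)), for `d ∈ 𝒩(E, K)`, `d > 0`, `d ≡ 1 (mod 12)`, `7 ∤ d`: every
`W'` `ℚ`-isogenous to `E^{(d)}` or `E^{(d·d_K)}`. Everything about the base is discharged in the kernel
(`KrizLiJZeroSetting`, `KrizLi…` base file). [cite: KrizLi2019, Thm. 5.1 (2), Def. 4.1, §6 Ex. 6.2] -/
theorem isIsogenousToKrizLiTwistOfSmallCMBase_of_curve1323m1 {K : Type} [Field K] [NumberField K]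
    (hK : IsImaginaryQuadratic K) (h3 : jacobiSym (NumberField.discr K) 3 = 1)
    (hq : jacobiSym (NumberField.discr K) 7 = 1) (hSD : HasKrizLiStarDatum curve1323m1 K)
    {d : ℤ} (hd : KrizLi2019.InN curve1323m1 K d) (hd0 : 0 < d) (hd12 : d % 12 = 1) (hqd : ¬ (7 : ℤ) ∣ d)
    {W' : WeierstrassCurve ℚ}
    (hiso : IsIsogenous W' (curve1323m1.quadraticTwist (d : ℚ)) ∨
      IsIsogenous W' (curve1323m1.quadraticTwist ((d * NumberField.discr K : ℤ) : ℚ))) :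
    IsIsogenousToKrizLiTwistOfSmallCMBase W' := by
  haveI : Fact (2 : ℕ).Prime := ⟨Nat.prime_two⟩
  exact ⟨curve1323m1, inferInstance, inferInstance, inferInstance, hasCM_cubicA₃ (-2),
    conductorNorm_curve1323m1_lt, one_le_mordellWeilRank_curve1323m1, twoTorsion_cubicA₃ (-2),
    (by rw [localTamagawaNumber_two_cubicA₃]; exact odd_one), K, inferInstance, inferInstance, hK,
    satisfiesHeegnerHypothesis_curve1323m1 hK.1 h3 hq, hSD, d, hd,
    sign_mul_jacobiSym_conductorNorm_curve1323m1 hd0 hd12 hqd, hiso⟩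

/-- **`d ∈ 𝒩(1323m1, K)` from EXPLICIT, DECIDABLE data on the prime factors of `d`**: `d ≡ 1 (mod 4)`,
`|d|` square-free, and every prime `ℓ ∣ d` has `ℓ ∉ {2, 3, 7}`, `(d_K/ℓ) = 1` and an even number of cube
roots of `−16(4·-2+1)` in `𝔽_ℓ`. [cite: KrizLi2019, Def. 4.1 (FMS) = arXiv Def. 3.1] -/
theorem inN_curve1323m1_of_explicit {K : Type} [Field K] [NumberField K] (h2 : Module.finrank ℚ K = 2)
    {d : ℤ} (hd4 : d % 4 = 1) (hsq : Squarefree d.natAbs)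
    (hprimes : ∀ (ℓ : ℕ) (hℓ : ℓ.Prime), ℓ ∣ d.natAbs → haveI : NeZero ℓ := ⟨hℓ.ne_zero⟩;
      ℓ ≠ 2 ∧ ℓ ≠ 3 ∧ ℓ ≠ 7 ∧ jacobiSym (NumberField.discr K) ℓ = 1 ∧
      Even ((Finset.univ.filter fun x : ZMod ℓ => x ^ 3 = -(16 * (4 * (-2 : ZMod ℓ) + 1))).card)) :
    KrizLi2019.InN curve1323m1 K d := by
  refine inN_of_explicit (S := fun ℓ => ∃ hℓ : ℓ.Prime, haveI : NeZero ℓ := ⟨hℓ.ne_zero⟩;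
      ℓ ≠ 2 ∧ ℓ ≠ 3 ∧ ℓ ≠ 7 ∧ jacobiSym (NumberField.discr K) ℓ = 1 ∧
      Even ((Finset.univ.filter fun x : ZMod ℓ => x ^ 3 = -(16 * (4 * (-2 : ZMod ℓ) + 1))).card))
    (fun ℓ ⟨hℓ, h⟩ => ?_) hd4 hsq (fun ℓ hℓ hℓd => ⟨hℓ, hprimes ℓ hℓ hℓd⟩)
  haveI : NeZero ℓ := ⟨hℓ.ne_zero⟩
  obtain ⟨hℓ2, hℓ3, hℓq, hj, hev⟩ := h
  have ha : ¬ (ℓ : ℤ) ∣ 4 * (-2) + 1 := fun h => by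
    have hℓp : Prime (ℓ : ℤ) := Nat.prime_iff_prime_int.mp hℓ
    have h' : (ℓ : ℤ) ∣ 7 ^ 5 := h.trans (by norm_num)
    exact hℓq ((Nat.prime_dvd_prime_iff_eq hℓ (by norm_num)).mp
      (Int.natCast_dvd_natCast.mp (by exact_mod_cast hℓp.dvd_of_dvd_pow h')))
  refine inS_of_explicit h2 hℓ hℓ2 (not_dvd_two_mul_conductorNorm_curve1323m1 hℓ hℓ2 hℓ3 hℓq) hj ?_
  rw [odd_frobeniusTrace_cubicA₃_iff (-2) hℓ hℓ2 hℓ3 ha]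
  push_cast at hev ⊢
  exact hev

/-- **Membership at the CERTIFIED field `K`, `d_K = −47`** (the lit seat's exact (★) certificate, cell
dossier §14.8, is stated for this pair). [cite: KrizLi2019, Thm. 5.1 (2) and §6 Ex. 6.2] -/
theorem isIsogenousToKrizLiTwistOfSmallCMBase_of_curve1323m1_of_discr_eq {K : Type} [Field K]
    [NumberField K] (hK : IsImaginaryQuadratic K) (hdK : NumberField.discr K = -47)
    (hSD : HasKrizLiStarDatum curve1323m1 K) {d : ℤ} (hd : KrizLi2019.InN curve1323m1 K d) (hd0 : 0 < d)
    (hd12 : d % 12 = 1) (hqd : ¬ (7 : ℤ) ∣ d) {W' : WeierstrassCurve ℚ}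
    (hiso : IsIsogenous W' (curve1323m1.quadraticTwist (d : ℚ)) ∨
      IsIsogenous W' (curve1323m1.quadraticTwist ((-47 * d : ℤ) : ℚ))) :
    IsIsogenousToKrizLiTwistOfSmallCMBase W' := by
  refine isIsogenousToKrizLiTwistOfSmallCMBase_of_curve1323m1 hK (by rw [hdK]; norm_num)
    (by rw [hdK]; norm_num) hSD hd hd0 hd12 hqd ?_
  rw [hdK, mul_comm]
  exact hiso

/-! ### `4563a1` (`= cubicA₃ 92823`, good at `2`; certified field `ℚ(√−23)`) -/

/-- **The Kriz–Li classes of `4563a1` are MEMBERS of the generic family** — in ANY imaginary quadratic `K`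
with `(d_K/3) = (d_K/13) = 1` carrying a (★)-datum `hSD : HasKrizLiStarDatum curve4563a1 K` (the DISPLAYED
certificate; `2` split in `K` is inside (★)), for `d ∈ 𝒩(E, K)`, `d > 0`, `d ≡ 1 (mod 12)`, `13 ∤ d`: every
`W'` `ℚ`-isogenous to `E^{(d)}` or `E^{(d·d_K)}`. Everything about the base is discharged in the kernel
(`KrizLiJZeroSetting`, `KrizLi…` base file). [cite: KrizLi2019, Thm. 5.1 (2), Def. 4.1, §6 Ex. 6.2] -/
theorem isIsogenousToKrizLiTwistOfSmallCMBase_of_curve4563a1 {K : Type} [Field K] [NumberField K]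
    (hK : IsImaginaryQuadratic K) (h3 : jacobiSym (NumberField.discr K) 3 = 1)
    (hq : jacobiSym (NumberField.discr K) 13 = 1) (hSD : HasKrizLiStarDatum curve4563a1 K)
    {d : ℤ} (hd : KrizLi2019.InN curve4563a1 K d) (hd0 : 0 < d) (hd12 : d % 12 = 1) (hqd : ¬ (13 : ℤ) ∣ d)
    {W' : WeierstrassCurve ℚ}
    (hiso : IsIsogenous W' (curve4563a1.quadraticTwist (d : ℚ)) ∨
      IsIsogenous W' (curve4563a1.quadraticTwist ((d * NumberField.discr K : ℤ) : ℚ))) :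
    IsIsogenousToKrizLiTwistOfSmallCMBase W' := by
  haveI : Fact (2 : ℕ).Prime := ⟨Nat.prime_two⟩
  exact ⟨curve4563a1, inferInstance, inferInstance, inferInstance, hasCM_cubicA₃ 92823,
    conductorNorm_curve4563a1_lt, one_le_mordellWeilRank_curve4563a1, twoTorsion_cubicA₃ 92823,
    (by rw [localTamagawaNumber_two_cubicA₃]; exact odd_one), K, inferInstance, inferInstance, hK,
    satisfiesHeegnerHypothesis_curve4563a1 hK.1 h3 hq, hSD, d, hd,
    sign_mul_jacobiSym_conductorNorm_curve4563a1 hd0 hd12 hqd, hiso⟩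

/-- **`d ∈ 𝒩(4563a1, K)` from EXPLICIT, DECIDABLE data on the prime factors of `d`**: `d ≡ 1 (mod 4)`,
`|d|` square-free, and every prime `ℓ ∣ d` has `ℓ ∉ {2, 3, 13}`, `(d_K/ℓ) = 1` and an even number of cube
roots of `−16(4·92823+1)` in `𝔽_ℓ`. [cite: KrizLi2019, Def. 4.1 (FMS) = arXiv Def. 3.1] -/
theorem inN_curve4563a1_of_explicit {K : Type} [Field K] [NumberField K] (h2 : Module.finrank ℚ K = 2)
    {d : ℤ} (hd4 : d % 4 = 1) (hsq : Squarefree d.natAbs)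
    (hprimes : ∀ (ℓ : ℕ) (hℓ : ℓ.Prime), ℓ ∣ d.natAbs → haveI : NeZero ℓ := ⟨hℓ.ne_zero⟩;
      ℓ ≠ 2 ∧ ℓ ≠ 3 ∧ ℓ ≠ 13 ∧ jacobiSym (NumberField.discr K) ℓ = 1 ∧
      Even ((Finset.univ.filter fun x : ZMod ℓ => x ^ 3 = -(16 * (4 * (92823 : ZMod ℓ) + 1))).card)) :
    KrizLi2019.InN curve4563a1 K d := by
  refine inN_of_explicit (S := fun ℓ => ∃ hℓ : ℓ.Prime, haveI : NeZero ℓ := ⟨hℓ.ne_zero⟩;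
      ℓ ≠ 2 ∧ ℓ ≠ 3 ∧ ℓ ≠ 13 ∧ jacobiSym (NumberField.discr K) ℓ = 1 ∧
      Even ((Finset.univ.filter fun x : ZMod ℓ => x ^ 3 = -(16 * (4 * (92823 : ZMod ℓ) + 1))).card))
    (fun ℓ ⟨hℓ, h⟩ => ?_) hd4 hsq (fun ℓ hℓ hℓd => ⟨hℓ, hprimes ℓ hℓ hℓd⟩)
  haveI : NeZero ℓ := ⟨hℓ.ne_zero⟩
  obtain ⟨hℓ2, hℓ3, hℓq, hj, hev⟩ := h
  have ha : ¬ (ℓ : ℤ) ∣ 4 * 92823 + 1 := fun h => by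
    have hℓp : Prime (ℓ : ℤ) := Nat.prime_iff_prime_int.mp hℓ
    have h' : (ℓ : ℤ) ∣ 13 ^ 5 := h.trans (by norm_num)
    exact hℓq ((Nat.prime_dvd_prime_iff_eq hℓ (by norm_num)).mp
      (Int.natCast_dvd_natCast.mp (by exact_mod_cast hℓp.dvd_of_dvd_pow h')))
  refine inS_of_explicit h2 hℓ hℓ2 (not_dvd_two_mul_conductorNorm_curve4563a1 hℓ hℓ2 hℓ3 hℓq) hj ?_
  rw [odd_frobeniusTrace_cubicA₃_iff 92823 hℓ hℓ2 hℓ3 ha]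
  push_cast at hev ⊢
  exact hev

/-- **Membership at the CERTIFIED field `K`, `d_K = −23`** (the lit seat's exact (★) certificate, cell
dossier §14.8, is stated for this pair). [cite: KrizLi2019, Thm. 5.1 (2) and §6 Ex. 6.2] -/
theorem isIsogenousToKrizLiTwistOfSmallCMBase_of_curve4563a1_of_discr_eq {K : Type} [Field K]
    [NumberField K] (hK : IsImaginaryQuadratic K) (hdK : NumberField.discr K = -23)
    (hSD : HasKrizLiStarDatum curve4563a1 K) {d : ℤ} (hd : KrizLi2019.InN curve4563a1 K d) (hd0 : 0 < d)
    (hd12 : d % 12 = 1) (hqd : ¬ (13 : ℤ) ∣ d) {W' : WeierstrassCurve ℚ}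
    (hiso : IsIsogenous W' (curve4563a1.quadraticTwist (d : ℚ)) ∨
      IsIsogenous W' (curve4563a1.quadraticTwist ((-23 * d : ℤ) : ℚ))) :
    IsIsogenousToKrizLiTwistOfSmallCMBase W' := by
  refine isIsogenousToKrizLiTwistOfSmallCMBase_of_curve4563a1 hK (by rw [hdK]; norm_num)
    (by rw [hdK]; norm_num) hSD hd hd0 hd12 hqd ?_
  rw [hdK, mul_comm]
  exact hiso


end Summit.BirchSwinnertonDyer.Rank1Residual.P2
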